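import Literature.Computability.AlgebraicComplexity.DeterminantalConormalBoundProofs
import Literature.Computability.AlgebraicComplexity.DeterminantalConormalBoundPlane
import Literature.Computability.AlgebraicComplexity.DeterminantalComplexityProofs
import Mathlib.RingTheory.MvPolynomial.EulerIdentity
import Mathlib.Algebra.CharZero.Infinite
import Mathlib.LinearAlgebra.FiniteDimensional.Lemmas
import HarnessLib

/-!
# Sheshadri's determinantal conormal bound — the case `m ≤ 2` (hyperplanes and quadrics)

This file accompanies `DeterminantalConormalBound.lean` (the named fact
`Sheshadri2026_polarCount_le`, K. Sheshadri, arXiv:2606.13628, Thm. 3 (i) in polar-count form),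
`DeterminantalConormalBoundProofs.lean` (kernel lift; the degenerate range `2m < N`) and
`DeterminantalConormalBoundPlane.lean` (the case `N = 3`). It proves the fact's conclusion for
determinantal size `m ≤ 2` and every `N = |σ| ≥ 3`
(`Sheshadri2026_polarCount_le_of_m_le_two`). For `2m < N` this is the degenerate range; the
remaining cases are `m = 2`, `N ∈ {3, 4}` with `B(2, 3) = 3`, `B(2, 4) = 2`, where `f = det A`
is a form of degree `d ≤ 2`, and the bound holds for ALL pencil/chart data `(a, b, c)`:

* a quadric has at most two polar points or infinitely many
  (`ncard_polarSet_le_two_of_isHomogeneous_two`, from the matrix statement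
  `ncard_quadricPolar_le_two`): writing `∇f(x) = M x`, `f(x) = ½ x·Mx` with the symmetric
  matrix `M = ((∂ⱼ∂ₖ f)(0))` (Euler's identity in degrees `1` and `2`,
  `pderiv_eq_sum_of_isHomogeneous_two`, `eval_eq_half_dotProduct_mulVec_of_isHomogeneous_two`),
  three distinct polar points `x₁, x₂, x₃` yield a linear relation `Σ αᵢ M xᵢ = 0` among the
  `M xᵢ ∈ ℂa + ℂb`, i.e. a kernel vector `v = Σ αᵢ xᵢ` of `M`; if `v = 0` the points are
  collinear and the whole line is polar, if `c·v = 0` the translates `x₁ + t v` are polar, and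
  otherwise the line through `x₁` and `v/(c·v)` is polar — in each case a punctured line of polar
  points, so the polar set is infinite and its `Set.ncard` is `0` (the elementary content of
  "a quadric has class `≤ 2`");
* a hyperplane has `Set.ncard T_f = 0` (`ncard_polarSet_eq_zero_of_isHomogeneous_one`: the
  polar set is cut out by two affine-linear conditions in `≥ 3` unknowns, hence empty or
  infinite), and a constant has `T_f = ∅`.

Everything here is a theorem (no definitions, no named facts — D-0026). Together with the two
sibling files, the named fact is now proved for `N = 3` (all `m`), for `m ≤ 2` (all `N`) and for
`N > 2m`, and more generally for all forms of degree `≤ 2`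
(`Sheshadri2026_polarCount_le_of_totalDegree_le_two`, using `B(m, N) ≥ 2` on `3 ≤ N ≤ 2m`,
`two_le_conormalBezout`) — collected in `Sheshadri2026_polarCount_le_of_small_cases`; the range
of forms of degree `≥ 3` with `m ≥ 3`, `4 ≤ N ≤ 2m` is the intersection-theoretic content of the
cited claim and remains a hypothesis.

## References

* K. Sheshadri, arXiv:2606.13628 (2026), Thm. 3 (i). [Sheshadri2026Border] — unrefereed claim;
  only its cases `m ≤ 2` are touched here, where it is classical linear algebra.
-/

namespace Literature.Computability.AlgebraicComplexity.DeterminantalConormal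

open MvPolynomial _root_.Matrix

section Quadric

variable {σ : Type*}

/-- Partial derivatives commute. [folklore] -/
theorem pderiv_pderiv_comm {R : Type*} [CommSemiring R] (i j : σ) (p : MvPolynomial σ R) :
    pderiv i (pderiv j p) = pderiv j (pderiv i p) := by
  classical
  rcases eq_or_ne i j with rfl | hij
  · rfl
  ext m
  simp only [coeff_pderiv, Finsupp.add_apply, Finsupp.single_apply, if_neg hij,
    if_neg hij.symm, add_zero]
  rw [add_right_comm m (Finsupp.single i 1) (Finsupp.single j 1)]
  ring

/-- A form of degree `0` is a constant. [folklore] -/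
theorem eq_C_of_isHomogeneous_zero {R : Type*} [CommSemiring R] {p : MvPolynomial σ R}
    (hp : p.IsHomogeneous 0) : p = C (coeff 0 p) :=
  totalDegree_eq_zero_iff_eq_C.mp ((totalDegree_zero_iff_isHomogeneous _).mpr hp)

/-- The Hessian-type matrix `M_{kj} = (∂ⱼ∂ₖ f)(0)` of a form is symmetric. [folklore] -/
theorem hessian_transpose_eq (f : MvPolynomial σ ℂ) :
    (Matrix.of fun k j => coeff 0 (pderiv j (pderiv k f))).transpose =
      Matrix.of fun k j => coeff 0 (pderiv j (pderiv k f)) := by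
  ext k j
  simp only [transpose_apply, of_apply]
  rw [pderiv_pderiv_comm]

variable [Fintype σ]

/-- A form of degree `1` is the linear form `Σⱼ (∂ⱼ p)(0) · xⱼ` (Euler's identity in degree `1`).
[folklore] -/
theorem eq_sum_C_mul_X_of_isHomogeneous_one {p : MvPolynomial σ ℂ} (hp : p.IsHomogeneous 1) :
    p = ∑ j, C (coeff 0 (pderiv j p)) * X j := by
  have h := hp.sum_X_mul_pderiv
  rw [one_smul] at h
  conv_lhs => rw [← h]
  refine Finset.sum_congr rfl fun j _ => ?_
  rw [mul_comm]
  congr 1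
  exact eq_C_of_isHomogeneous_zero hp.pderiv

/-- **The gradient of a quadratic form is linear**: for a form `f` of degree `2`,
`∂ₖ f = Σⱼ M_{kj} xⱼ` with `M_{kj} = (∂ⱼ∂ₖ f)(0)`. [folklore] -/
theorem pderiv_eq_sum_of_isHomogeneous_two {f : MvPolynomial σ ℂ} (hf : f.IsHomogeneous 2)
    (k : σ) : pderiv k f = ∑ j, C (coeff 0 (pderiv j (pderiv k f))) * X j :=
  eq_sum_C_mul_X_of_isHomogeneous_one hf.pderiv

/-- **Euler's identity for a quadratic form**: `f = ½ Σₖ xₖ ∂ₖ f`. [folklore] -/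
theorem eq_half_sum_X_mul_pderiv_of_isHomogeneous_two {f : MvPolynomial σ ℂ}
    (hf : f.IsHomogeneous 2) : f = C (1 / 2 : ℂ) * ∑ k, X k * pderiv k f := by
  rw [hf.sum_X_mul_pderiv, nsmul_eq_mul, Nat.cast_ofNat, ← mul_assoc]
  have h2 : (C (1 / 2 : ℂ) : MvPolynomial σ ℂ) * 2 = 1 := by
    rw [show (2 : MvPolynomial σ ℂ) = C 2 from (map_ofNat C 2).symm, ← C_mul]
    norm_num
  rw [h2, one_mul]

/-- Evaluation of the gradient of a quadratic form: `∇f(x) = M x`. [folklore] -/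
theorem eval_pderiv_eq_mulVec_of_isHomogeneous_two {f : MvPolynomial σ ℂ}
    (hf : f.IsHomogeneous 2) (x : σ → ℂ) (k : σ) :
    eval x (pderiv k f) = ((Matrix.of fun k j => coeff 0 (pderiv j (pderiv k f))) *ᵥ x) k := by
  conv_lhs => rw [pderiv_eq_sum_of_isHomogeneous_two hf k]
  simp [mulVec, dotProduct]

/-- Evaluation of a quadratic form: `f(x) = ½ x · M x`. [folklore] -/
theorem eval_eq_half_dotProduct_mulVec_of_isHomogeneous_two {f : MvPolynomial σ ℂ}
    (hf : f.IsHomogeneous 2) (x : σ → ℂ) :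
    eval x f = (1 / 2 : ℂ) *
      (x ⬝ᵥ ((Matrix.of fun k j => coeff 0 (pderiv j (pderiv k f))) *ᵥ x)) := by
  conv_lhs => rw [eq_half_sum_X_mul_pderiv_of_isHomogeneous_two hf]
  rw [map_mul, eval_C, map_sum]
  congr 1
  simp only [map_mul, eval_X, eval_pderiv_eq_mulVec_of_isHomogeneous_two hf, dotProduct]

/-- Three vectors in the plane `ℂ²` satisfy a non-trivial linear relation (explicitly, by
`2 × 2` determinants), provided the first one is non-zero. [folklore] -/
theorem exists_relation_of_three (s₁ t₁ s₂ t₂ s₃ t₃ : ℂ) (h₁ : s₁ ≠ 0 ∨ t₁ ≠ 0) :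
    ∃ α₁ α₂ α₃ : ℂ, (α₁ ≠ 0 ∨ α₂ ≠ 0 ∨ α₃ ≠ 0) ∧
      α₁ * s₁ + α₂ * s₂ + α₃ * s₃ = 0 ∧ α₁ * t₁ + α₂ * t₂ + α₃ * t₃ = 0 := by
  by_cases hdet : s₁ * t₂ - s₂ * t₁ = 0
  · rcases h₁ with hs | ht
    · exact ⟨s₂, -s₁, 0, Or.inr (Or.inl (neg_ne_zero.mpr hs)), by ring,
        by linear_combination -hdet⟩
    · exact ⟨t₂, -t₁, 0, Or.inr (Or.inl (neg_ne_zero.mpr ht)), by linear_combination hdet,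
        by ring⟩
  · exact ⟨s₂ * t₃ - s₃ * t₂, s₃ * t₁ - s₁ * t₃, s₁ * t₂ - s₂ * t₁, Or.inr (Or.inr hdet),
      by ring, by ring⟩

/-- **At most two polar points of a quadric, or infinitely many.** Let `M` be a symmetric matrix
over `ℂ` and `q(x) = x · M x`. For all pencil/chart data `(a, b, c)`, the set of `x` with
`q(x) = 0`, `M x ≠ 0`, `M x ∈ ℂa + ℂb` and `c · x = 1` has `Set.ncard ≤ 2`: if it contains
three distinct points `x₁, x₂, x₃` then it contains a punctured line (through two of them if
they are collinear; otherwise through `x₁` in the direction of, or through the normalised, kernel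
vector `Σ αᵢ xᵢ` of `M` furnished by a linear relation among the `M xᵢ ∈ ℂa + ℂb`), hence is
infinite and has `ncard = 0`. This is the elementary content of "a quadric has class `≤ 2`".
[folklore] -/
theorem ncard_quadricPolar_le_two {M : Matrix σ σ ℂ} (hM : M.transpose = M) (a b c : σ → ℂ) :
    {x : σ → ℂ | x ⬝ᵥ (M *ᵥ x) = 0 ∧ M *ᵥ x ≠ 0 ∧ (∃ s t : ℂ, M *ᵥ x = s • a + t • b) ∧
      c ⬝ᵥ x = 1}.ncard ≤ 2 := by
  haveI : Infinite ℂ := CharZero.infinite ℂ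
  set T := {x : σ → ℂ | x ⬝ᵥ (M *ᵥ x) = 0 ∧ M *ᵥ x ≠ 0 ∧ (∃ s t : ℂ, M *ᵥ x = s • a + t • b) ∧
      c ⬝ᵥ x = 1} with hT
  -- symmetric bilinear algebra
  have hsymm : ∀ x y : σ → ℂ, y ⬝ᵥ (M *ᵥ x) = x ⬝ᵥ (M *ᵥ y) := by
    intro x y
    rw [dotProduct_mulVec, ← mulVec_transpose, hM, dotProduct_comm]
  have hexp : ∀ (x d : σ → ℂ) (t : ℂ), (x + t • d) ⬝ᵥ (M *ᵥ (x + t • d)) =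
      x ⬝ᵥ (M *ᵥ x) + 2 * t * (x ⬝ᵥ (M *ᵥ d)) + t ^ 2 * (d ⬝ᵥ (M *ᵥ d)) := by
    intro x d t
    rw [mulVec_add, mulVec_smul, add_dotProduct, dotProduct_add, dotProduct_add, smul_dotProduct,
      smul_dotProduct, dotProduct_smul, dotProduct_smul, hsymm x d]
    simp only [smul_eq_mul]
    ring
  -- a punctured line inside `T` makes it infinite
  have hline : ∀ (x d : σ → ℂ), d ≠ 0 → (∀ t : ℂ, (x + t • d) ⬝ᵥ (M *ᵥ (x + t • d)) = 0) →
      (∀ t : ℂ, ∃ s u : ℂ, M *ᵥ (x + t • d) = s • a + u • b) →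
      (∀ t : ℂ, c ⬝ᵥ (x + t • d) = 1) →
      {t : ℂ | M *ᵥ (x + t • d) = 0}.Subsingleton → T.Infinite := by
    intro x d hd hq hspan hc hsub
    have hinj : Set.InjOn (fun t : ℂ => x + t • d) {t : ℂ | M *ᵥ (x + t • d) = 0}ᶜ := by
      intro t _ t' _ h
      have h' : (t - t') • d = 0 := by
        rw [sub_smul, sub_eq_zero]
        exact add_left_cancel h
      exact sub_eq_zero.mp ((smul_eq_zero.mp h').resolve_right hd)
    refine Set.Infinite.mono ?_ ((hsub.finite.infinite_compl).image hinj)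
    rintro _ ⟨t, ht, rfl⟩
    exact ⟨hq t, ht, hspan t, hc t⟩
  by_contra hlt
  push Not at hlt
  have hfin : T.Finite := Set.finite_of_ncard_pos (by omega)
  suffices hinf : T.Infinite from hinf hfin
  obtain ⟨x₁, hx₁, x₂, hx₂, x₃, hx₃, h12, h13, h23⟩ := (Set.two_lt_ncard hfin).mp hlt
  -- the collinear case, stated once for any ordering of the three points
  have hcol : ∀ y₁ ∈ T, ∀ y₂ ∈ T, ∀ y₃ ∈ T, y₁ ≠ y₂ → y₁ ≠ y₃ → y₂ ≠ y₃ →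
      ∀ β₁ β₂ β₃ : ℂ, β₁ • y₁ + β₂ • y₂ + β₃ • y₃ = 0 → β₁ + β₂ + β₃ = 0 → β₃ ≠ 0 →
      T.Infinite := by
    intro y₁ hy₁ y₂ hy₂ y₃ hy₃ h12 h13 h23 β₁ β₂ β₃ hrel hsum hβ₃
    obtain ⟨hq₁, hM₁, ⟨s₁, t₁, hst₁⟩, hc₁⟩ := hy₁
    obtain ⟨hq₂, -, ⟨s₂, t₂, hst₂⟩, hc₂⟩ := hy₂
    obtain ⟨hq₃, -, -, -⟩ := hy₃
    set d := y₂ - y₁ with hd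
    have hd0 : d ≠ 0 := fun h0 => h12 (sub_eq_zero.mp h0).symm
    have h12' : β₁ + β₂ ≠ 0 := by
      intro h0
      apply hβ₃
      linear_combination hsum - h0
    set μ := β₂ / (β₁ + β₂) with hμ
    have hy₃ : y₃ = y₁ + μ • d := by
      have h3 : y₃ = (-(β₃)⁻¹) • (β₁ • y₁ + β₂ • y₂) := by
        have : β₃ • y₃ = -(β₁ • y₁ + β₂ • y₂) := by
          rw [eq_neg_iff_add_eq_zero, add_comm, hrel]
        calc y₃ = (β₃)⁻¹ • (β₃ • y₃) := by rw [smul_smul, inv_mul_cancel₀ hβ₃, one_smul]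
          _ = (-(β₃)⁻¹) • (β₁ • y₁ + β₂ • y₂) := by rw [this, smul_neg, neg_smul]
      have hβ₃' : β₃ = -(β₁ + β₂) := by linear_combination hsum
      rw [h3, hd, hμ, hβ₃']
      funext i
      simp only [Pi.smul_apply, Pi.add_apply, Pi.sub_apply, smul_eq_mul]
      field_simp
      ring
    have hμ0 : μ ≠ 0 := by
      intro h0
      apply h13
      rw [hy₃, h0, zero_smul, add_zero]
    have hμ1 : μ ≠ 1 := by
      intro h1
      apply h23
      rw [hy₃, h1, one_smul, hd, add_sub_cancel]
    -- `q` vanishes identically on the line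
    have hB : y₁ ⬝ᵥ (M *ᵥ d) = 0 ∧ d ⬝ᵥ (M *ᵥ d) = 0 := by
      have e2 := hexp y₁ d 1
      rw [one_smul, show y₁ + d = y₂ by rw [hd, add_sub_cancel], hq₂, hq₁] at e2
      have e3 := hexp y₁ d μ
      rw [← hy₃, hq₃, hq₁] at e3
      have e3' : 2 * (y₁ ⬝ᵥ (M *ᵥ d)) + μ * (d ⬝ᵥ (M *ᵥ d)) = 0 := by
        have : μ * (2 * (y₁ ⬝ᵥ (M *ᵥ d)) + μ * (d ⬝ᵥ (M *ᵥ d))) = 0 := by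
          linear_combination -e3
        exact (mul_eq_zero.mp this).resolve_left hμ0
      have hdd : d ⬝ᵥ (M *ᵥ d) = 0 := by
        have : (1 - μ) * (d ⬝ᵥ (M *ᵥ d)) = 0 := by linear_combination -e2 - e3'
        exact (mul_eq_zero.mp this).resolve_left (sub_ne_zero.mpr (Ne.symm hμ1))
      refine ⟨?_, hdd⟩
      have : 2 * (y₁ ⬝ᵥ (M *ᵥ d)) = 0 := by linear_combination -e2 - hdd
      exact (mul_eq_zero.mp this).resolve_left two_ne_zero
    have hMd : M *ᵥ d = M *ᵥ y₂ - M *ᵥ y₁ := by rw [hd, mulVec_sub]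
    refine hline y₁ d hd0 (fun t => ?_) (fun t => ?_) (fun t => ?_) ?_
    · rw [hexp, hq₁, hB.1, hB.2]; ring
    · refine ⟨s₁ + t * (s₂ - s₁), t₁ + t * (t₂ - t₁), ?_⟩
      rw [mulVec_add, mulVec_smul, hMd, hst₁, hst₂]
      simp only [smul_add, smul_sub, smul_smul, add_smul]
      abel_nf
      module
    · rw [dotProduct_add, dotProduct_smul, hc₁, hd, dotProduct_sub, hc₂, hc₁, sub_self,
        smul_zero, add_zero]
    · intro t ht t' ht'
      simp only [Set.mem_setOf_eq, mulVec_add, mulVec_smul] at ht ht'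
      by_cases hMd0 : M *ᵥ d = 0
      · rw [hMd0, smul_zero, add_zero] at ht
        exact absurd ht hM₁
      · have : (t - t') • (M *ᵥ d) = 0 := by
          rw [sub_smul, sub_eq_zero]
          exact add_left_cancel (ht.trans ht'.symm)
        exact sub_eq_zero.mp ((smul_eq_zero.mp this).resolve_right hMd0)
  obtain ⟨hq₁, hM₁, ⟨s₁, t₁, hst₁⟩, hc₁⟩ := hx₁
  obtain ⟨hq₂, hM₂, ⟨s₂, t₂, hst₂⟩, hc₂⟩ := hx₂
  obtain ⟨hq₃, hM₃, ⟨s₃, t₃, hst₃⟩, hc₃⟩ := hx₃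
  -- a non-trivial relation among the `(sᵢ, tᵢ)`
  have hst0 : s₁ ≠ 0 ∨ t₁ ≠ 0 := by
    by_contra h0
    push Not at h0
    apply hM₁
    rw [hst₁, h0.1, h0.2, zero_smul, zero_smul, add_zero]
  obtain ⟨α₁, α₂, α₃, hα, hαs, hαt⟩ := exists_relation_of_three s₁ t₁ s₂ t₂ s₃ t₃ hst0
  set v := α₁ • x₁ + α₂ • x₂ + α₃ • x₃ with hv
  have hMv : M *ᵥ v = 0 := by
    have h1 : M *ᵥ v = (α₁ * s₁ + α₂ * s₂ + α₃ * s₃) • a + (α₁ * t₁ + α₂ * t₂ + α₃ * t₃) • b := by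
      rw [hv, mulVec_add, mulVec_add, mulVec_smul, mulVec_smul, mulVec_smul, hst₁, hst₂, hst₃]
      module
    rw [h1, hαs, hαt, zero_smul, zero_smul, add_zero]
  have hcv : c ⬝ᵥ v = α₁ + α₂ + α₃ := by
    rw [hv, dotProduct_add, dotProduct_add, dotProduct_smul, dotProduct_smul, dotProduct_smul,
      hc₁, hc₂, hc₃, smul_eq_mul, smul_eq_mul, smul_eq_mul, mul_one, mul_one, mul_one]
  have hx₁T : x₁ ∈ T := ⟨hq₁, hM₁, ⟨s₁, t₁, hst₁⟩, hc₁⟩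
  have hx₂T : x₂ ∈ T := ⟨hq₂, hM₂, ⟨s₂, t₂, hst₂⟩, hc₂⟩
  have hx₃T : x₃ ∈ T := ⟨hq₃, hM₃, ⟨s₃, t₃, hst₃⟩, hc₃⟩
  by_cases hv0 : v = 0
  · -- collinear case
    have hsum : α₁ + α₂ + α₃ = 0 := by rw [← hcv, hv0, dotProduct_zero]
    rcases hα with h1 | h2 | h3
    · refine hcol x₂ hx₂T x₃ hx₃T x₁ hx₁T h23 (Ne.symm h12) (Ne.symm h13) α₂ α₃ α₁ ?_ ?_ h1
      · rw [← hv0, hv]; abel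
      · rw [← hsum]; ring
    · refine hcol x₁ hx₁T x₃ hx₃T x₂ hx₂T h13 h12 (Ne.symm h23) α₁ α₃ α₂ ?_ ?_ h2
      · rw [← hv0, hv]; abel
      · rw [← hsum]; ring
    · exact hcol x₁ hx₁T x₂ hx₂T x₃ hx₃T h12 h13 h23 α₁ α₂ α₃ (by rw [← hv0, hv]) hsum h3
  by_cases hcv0 : c ⬝ᵥ v = 0
  · -- translation by the kernel vector `v`
    refine hline x₁ v hv0 (fun t => ?_) (fun t => ⟨s₁, t₁, ?_⟩) (fun t => ?_) ?_
    · rw [hexp, hq₁, hMv, dotProduct_zero, dotProduct_zero]; ring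
    · rw [mulVec_add, mulVec_smul, hMv, smul_zero, add_zero, hst₁]
    · rw [dotProduct_add, dotProduct_smul, hc₁, hcv0, smul_zero, add_zero]
    · intro t ht
      simp only [Set.mem_setOf_eq, mulVec_add, mulVec_smul, hMv, smul_zero, add_zero] at ht
      exact absurd ht hM₁
  · -- the line through the normalised kernel vector `w` and `x₁`
    set w := (c ⬝ᵥ v)⁻¹ • v with hw
    have hMw : M *ᵥ w = 0 := by rw [hw, mulVec_smul, hMv, smul_zero]
    have hcw : c ⬝ᵥ w = 1 := by rw [hw, dotProduct_smul, smul_eq_mul, inv_mul_cancel₀ hcv0]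
    clear_value w
    have hd0 : x₁ - w ≠ 0 := by
      intro h0
      apply hM₁
      rw [sub_eq_zero.mp h0, hMw]
    have hwq : w ⬝ᵥ (M *ᵥ w) = 0 := by rw [hMw, dotProduct_zero]
    have hB : w ⬝ᵥ (M *ᵥ (x₁ - w)) = 0 := by
      rw [mulVec_sub, hMw, sub_zero, hsymm, hMw, dotProduct_zero]
    have hq' : (x₁ - w) ⬝ᵥ (M *ᵥ (x₁ - w)) = 0 := by
      rw [mulVec_sub, hMw, sub_zero, sub_dotProduct, hq₁, hsymm, hMw, dotProduct_zero, sub_zero]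
    refine hline w (x₁ - w) hd0 (fun t => ?_) (fun t => ⟨t * s₁, t * t₁, ?_⟩) (fun t => ?_) ?_
    · rw [hexp, hwq, hB, hq']; ring
    · rw [mulVec_add, hMw, zero_add, mulVec_smul, mulVec_sub, hMw, sub_zero, hst₁, smul_add,
        smul_smul, smul_smul]
    · rw [dotProduct_add, dotProduct_smul, hcw, dotProduct_sub, hc₁, hcw, sub_self, smul_zero,
        add_zero]
    · intro t ht t' ht'
      simp only [Set.mem_setOf_eq, mulVec_add, hMw, zero_add, mulVec_smul, mulVec_sub,
        sub_zero] at ht ht'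
      have h1 : t = 0 := by
        by_contra h
        exact hM₁ ((smul_eq_zero.mp ht).resolve_left h)
      have h2 : t' = 0 := by
        by_contra h
        exact hM₁ ((smul_eq_zero.mp ht').resolve_left h)
      rw [h1, h2]

/-- A common kernel vector of two linear functionals on `ℂ^σ`, `|σ| ≥ 3`. [folklore] -/
theorem exists_ne_zero_dotProduct_eq_zero_two (hσ : 3 ≤ Fintype.card σ) (w c : σ → ℂ) :
    ∃ d : σ → ℂ, d ≠ 0 ∧ w ⬝ᵥ d = 0 ∧ c ⬝ᵥ d = 0 := by
  set A : Matrix (Fin 2) σ ℂ := Matrix.of ![w, c] with hA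
  have hlt : Module.finrank ℂ (Fin 2 → ℂ) < Module.finrank ℂ (σ → ℂ) := by
    rw [Module.finrank_fin_fun, Module.finrank_fintype_fun_eq_card]
    omega
  obtain ⟨d, hd, hd0⟩ := (Submodule.ne_bot_iff _).mp
    (LinearMap.ker_ne_bot_of_finrank_lt (f := A.mulVecLin) hlt)
  rw [LinearMap.mem_ker, Matrix.mulVecLin_apply] at hd
  refine ⟨d, hd0, ?_, ?_⟩
  · have := congr_fun hd 0
    simpa [hA, Matrix.mulVec, Matrix.of_apply] using this
  · have := congr_fun hd 1
    simpa [hA, Matrix.mulVec, Matrix.of_apply] using this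

/-- **A quadric has at most two polar points (or infinitely many).** For every quadratic form
`f` on `ℂ^σ` and all pencil/chart data, `#T_f(a, b, c) ≤ 2` as a `Set.ncard` (no genericity
needed): `ncard_quadricPolar_le_two` for the symmetric matrix `M = ((∂ⱼ∂ₖ f)(0))`, for which
`∇f(x) = M x` and `f(x) = ½ x·Mx`. [folklore] -/
theorem ncard_polarSet_le_two_of_isHomogeneous_two {f : MvPolynomial σ ℂ}
    (hf : f.IsHomogeneous 2) (a b c : σ → ℂ) : (polarSet f a b c).ncard ≤ 2 := by
  set M : Matrix σ σ ℂ := Matrix.of fun k j => coeff 0 (pderiv j (pderiv k f)) with hMdef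
  have hset : polarSet f a b c = {x : σ → ℂ | x ⬝ᵥ (M *ᵥ x) = 0 ∧ M *ᵥ x ≠ 0 ∧
      (∃ s t : ℂ, M *ᵥ x = s • a + t • b) ∧ c ⬝ᵥ x = 1} := by
    ext x
    rw [mem_polarSet, Set.mem_setOf_eq, eval_eq_half_dotProduct_mulVec_of_isHomogeneous_two hf]
    simp only [eval_pderiv_eq_mulVec_of_isHomogeneous_two hf, ← hMdef]
    refine and_congr ?_ (and_congr ?_ (and_congr ?_ Iff.rfl))
    · rw [mul_eq_zero, or_iff_right (by norm_num)]
    · rw [Ne, funext_iff, not_forall]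
      rfl
    · refine exists_congr fun s => exists_congr fun t => ?_
      rw [funext_iff]
      rfl
  rw [hset]
  exact ncard_quadricPolar_le_two (hessian_transpose_eq f) a b c

/-- **A hyperplane has no polar points (as a count).** For a linear form `f` on `ℂ^σ`,
`|σ| ≥ 3`, and all pencil/chart data, `T_f(a, b, c)` is empty or infinite, so its `Set.ncard`
is `0`: it is cut out by the two affine-linear conditions `f(x) = 0`, `c·x = 1` (the conditions
on `∇f ≡ w` do not involve `x`), and translating by a common kernel vector of `w, c` stays inside.
[folklore] -/
theorem ncard_polarSet_eq_zero_of_isHomogeneous_one (hσ : 3 ≤ Fintype.card σ)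
    {f : MvPolynomial σ ℂ} (hf : f.IsHomogeneous 1) (a b c : σ → ℂ) :
    (polarSet f a b c).ncard = 0 := by
  haveI : Infinite ℂ := CharZero.infinite ℂ
  set w : σ → ℂ := fun j => coeff 0 (pderiv j f) with hw
  have hpd : ∀ j, pderiv j f = C (w j) := fun j => eq_C_of_isHomogeneous_zero hf.pderiv
  have hev : ∀ x, eval x f = w ⬝ᵥ x := by
    intro x
    conv_lhs => rw [eq_sum_C_mul_X_of_isHomogeneous_one hf]
    simp [dotProduct, hw]
  rcases (polarSet f a b c).eq_empty_or_nonempty with h0 | ⟨x₀, hx₀⟩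
  · rw [h0, Set.ncard_empty]
  refine Set.Infinite.ncard ?_
  obtain ⟨hf0, hgrad, hspan, hc0⟩ := hx₀
  obtain ⟨d, hd0, hwd, hcd⟩ := exists_ne_zero_dotProduct_eq_zero_two hσ w c
  have hinj : Function.Injective fun t : ℂ => x₀ + t • d := by
    intro t t' h
    have h' : (t - t') • d = 0 := by
      rw [sub_smul, sub_eq_zero]
      exact add_left_cancel h
    exact sub_eq_zero.mp ((smul_eq_zero.mp h').resolve_right hd0)
  refine Set.infinite_of_injective_forall_mem hinj fun t => ⟨?_, ?_, ?_, ?_⟩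
  · rw [hev] at hf0 ⊢
    rw [dotProduct_add, dotProduct_smul, hf0, hwd, smul_zero, add_zero]
  · simpa only [hpd, eval_C] using hgrad
  · simpa only [hpd, eval_C] using hspan
  · change c ⬝ᵥ (x₀ + t • d) = 1
    change c ⬝ᵥ x₀ = 1 at hc0
    rw [dotProduct_add, dotProduct_smul, hc0, hcd, smul_zero, add_zero]

/-- `B(2, 4) = 2`. [folklore] -/
theorem conormalBezout_two_four : conormalBezout 2 4 = 2 := by
  decide

omit [Fintype σ] in
/-- An interior binomial coefficient is at least `2`. [folklore] -/
theorem two_le_choose {n k : ℕ} (h1 : 1 ≤ k) (h2 : k + 1 ≤ n) : 2 ≤ n.choose k := by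
  obtain ⟨n', rfl⟩ : ∃ n', n = n' + 1 := ⟨n - 1, by omega⟩
  obtain ⟨k', rfl⟩ : ∃ k', k = k' + 1 := ⟨k - 1, by omega⟩
  rw [Nat.choose_succ_succ]
  have h3 : 0 < n'.choose k' := Nat.choose_pos (by omega)
  have h4 : 0 < n'.choose k'.succ := Nat.choose_pos (by omega)
  omega

omit [Fintype σ] in
/-- **`B(m, N) ≥ 2` throughout the non-degenerate range** `m ≥ 2`, `3 ≤ N ≤ 2m` (the term
`i = N − 1` if `N ≤ m`, the term `i = N − m` otherwise). [folklore] -/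
theorem two_le_conormalBezout {m N : ℕ} (hm : 2 ≤ m) (hN3 : 3 ≤ N) (hN : N ≤ 2 * m) :
    2 ≤ conormalBezout m N := by
  rw [conormalBezout]
  by_cases hNm : N ≤ m
  · refine le_trans ?_ (Finset.single_le_sum (fun i _ => Nat.zero_le _)
      (Finset.mem_Icc.mpr ⟨by omega, le_refl (N - 1)⟩))
    rw [show N - 1 - (N - 1) = 0 by omega, Nat.choose_zero_right, mul_one,
      show N - 1 - 1 = N - 2 by omega, Nat.choose_self, mul_one]
    exact two_le_choose (by omega) (by omega)
  · refine le_trans ?_ (Finset.single_le_sum (fun i _ => Nat.zero_le _)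
      (Finset.mem_Icc.mpr ⟨by omega, by omega⟩ : N - m ∈ Finset.Icc 1 (N - 1)))
    rw [show N - 1 - (N - m) = m - 1 by omega, Nat.choose_self, mul_one]
    have h1 : 0 < (N - 2).choose (N - m - 1) := Nat.choose_pos (by omega)
    have h2 : 0 < m.choose (N - m) := Nat.choose_pos (by omega)
    rcases Nat.lt_or_ge N (2 * m) with hlt | hge
    · have h3 : 2 ≤ m.choose (N - m) := two_le_choose (by omega) (by omega)
      nlinarith
    · have hNeq : N = 2 * m := le_antisymm hN hge
      have h3 : 2 ≤ (N - 2).choose (N - m - 1) := two_le_choose (by omega) (by omega)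
      nlinarith

end Quadric

end Literature.Computability.AlgebraicComplexity.DeterminantalConormal

namespace Literature.Computability.AlgebraicComplexity

open MvPolynomial

/-- **`Sheshadri2026_polarCount_le` for `m ≤ 2` (determinants of size `≤ 2`: hyperplanes and
quadrics), all `N = |σ| ≥ 3`.** If `2m < N` this is the degenerate range
(`Sheshadri2026_polarCount_le_of_two_mul_lt`, generic polar set empty). Otherwise `m = 2` and
`N ∈ {3, 4}`, where `B(2, 3) = 3`, `B(2, 4) = 2`, and for every `(a, b, c)` (no genericity
needed, `Φ = 1`): `f` has degree `d ≤ 2` (`totalDegree_le_of_hasDetRepr_holds`); a quadric has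
`ncard T_f ≤ 2` (`ncard_polarSet_le_two_of_isHomogeneous_two`: three polar points force a
punctured line of them), a hyperplane has `ncard T_f = 0`
(`ncard_polarSet_eq_zero_of_isHomogeneous_one`), a constant has `T_f = ∅`. [folklore] -/
theorem Sheshadri2026_polarCount_le_of_m_le_two {σ : Type} [Fintype σ] [DecidableEq σ]
    (hσ : 3 ≤ Fintype.card σ) (f : MvPolynomial σ ℂ) (d m : ℕ) (hm2 : m ≤ 2)
    (hf : f.IsHomogeneous d) (hm : HasDetRepr f m) :
    ∃ Φ : MvPolynomial (Fin 3 × σ) ℂ, Φ ≠ 0 ∧ ∀ u : Fin 3 × σ → ℂ, eval u Φ ≠ 0 →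
      (polarSet f (fun i => u (0, i)) (fun i => u (1, i)) (fun i => u (2, i))).ncard ≤
        conormalBezout m (Fintype.card σ) := by
  by_cases hlt : 2 * m < Fintype.card σ
  · exact Sheshadri2026_polarCount_le_of_two_mul_lt f m hlt hm
  have hm' : m = 2 := by omega
  subst hm'
  refine ⟨1, one_ne_zero, fun u _ => ?_⟩
  -- the count is at most `2` for every `(a, b, c)`
  have hle : (polarSet f (fun i => u (0, i)) (fun i => u (1, i)) (fun i => u (2, i))).ncard ≤ 2 := by
    by_cases hf0 : f = 0
    · rw [hf0, polarSet_zero, Set.ncard_empty]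
      exact Nat.zero_le _
    have hd : d ≤ 2 := by
      rw [← hf.totalDegree hf0]
      exact totalDegree_le_of_hasDetRepr_holds hm
    interval_cases d
    · -- constants
      rw [(totalDegree_zero_iff_isHomogeneous _).mpr hf |> totalDegree_eq_zero_iff_eq_C.mp]
      have : polarSet (C (coeff 0 f) : MvPolynomial σ ℂ) (fun i => u (0, i)) (fun i => u (1, i))
          (fun i => u (2, i)) = ∅ := by
        ext x
        simp [polarSet]
      rw [this, Set.ncard_empty]
      exact Nat.zero_le _
    · rw [DeterminantalConormal.ncard_polarSet_eq_zero_of_isHomogeneous_one hσ hf]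
      exact Nat.zero_le _
    · exact DeterminantalConormal.ncard_polarSet_le_two_of_isHomogeneous_two hf _ _ _
  refine hle.trans ?_
  obtain h3 | h4 : Fintype.card σ = 3 ∨ Fintype.card σ = 4 := by omega
  · rw [h3, conormalBezout_three]
    decide
  · rw [h4, DeterminantalConormal.conormalBezout_two_four]

/-- **`Sheshadri2026_polarCount_le` for forms of degree `≤ 2` (any determinantal size `m`), all
`N = |σ| ≥ 3.** If `2m < N` this is the degenerate range; otherwise `m ≥ 2`, `B(m, N) ≥ 2`
(`two_le_conormalBezout`) and for every `(a, b, c)` a quadric has `ncard T_f ≤ 2`, a hyperplane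
`ncard T_f = 0`, a constant `T_f = ∅` (`Φ = 1`). This strictly contains the case `m ≤ 2`
(`totalDegree f ≤ m`). [folklore] -/
theorem Sheshadri2026_polarCount_le_of_totalDegree_le_two {σ : Type} [Fintype σ] [DecidableEq σ]
    (hσ : 3 ≤ Fintype.card σ) (f : MvPolynomial σ ℂ) (d m : ℕ) (hdeg : f.totalDegree ≤ 2)
    (hf : f.IsHomogeneous d) (hm : HasDetRepr f m) :
    ∃ Φ : MvPolynomial (Fin 3 × σ) ℂ, Φ ≠ 0 ∧ ∀ u : Fin 3 × σ → ℂ, eval u Φ ≠ 0 →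
      (polarSet f (fun i => u (0, i)) (fun i => u (1, i)) (fun i => u (2, i))).ncard ≤
        conormalBezout m (Fintype.card σ) := by
  by_cases hlt : 2 * m < Fintype.card σ
  · exact Sheshadri2026_polarCount_le_of_two_mul_lt f m hlt hm
  refine ⟨1, one_ne_zero, fun u _ => ?_⟩
  have hle : (polarSet f (fun i => u (0, i)) (fun i => u (1, i)) (fun i => u (2, i))).ncard ≤ 2 := by
    by_cases hf0 : f = 0
    · rw [hf0, polarSet_zero, Set.ncard_empty]
      exact Nat.zero_le _
    have hd : d ≤ 2 := by rwa [← hf.totalDegree hf0]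
    interval_cases d
    · rw [(totalDegree_zero_iff_isHomogeneous _).mpr hf |> totalDegree_eq_zero_iff_eq_C.mp]
      have : polarSet (C (coeff 0 f) : MvPolynomial σ ℂ) (fun i => u (0, i)) (fun i => u (1, i))
          (fun i => u (2, i)) = ∅ := by
        ext x
        simp [polarSet]
      rw [this, Set.ncard_empty]
      exact Nat.zero_le _
    · rw [DeterminantalConormal.ncard_polarSet_eq_zero_of_isHomogeneous_one hσ hf]
      exact Nat.zero_le _
    · exact DeterminantalConormal.ncard_polarSet_le_two_of_isHomogeneous_two hf _ _ _
  exact hle.trans (DeterminantalConormal.two_le_conormalBezout (by omega) hσ (by omega))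

/-- **The proved cases of `Sheshadri2026_polarCount_le`, in one statement.** The conclusion of
the named fact (arXiv:2606.13628, Thm. 3 (i) in polar-count form) holds whenever `N = |σ| = 3`
(plane curves, `Sheshadri2026_polarCount_le_of_card_eq_three`), or `deg f ≤ 2` (hyperplanes
and quadrics, `Sheshadri2026_polarCount_le_of_totalDegree_le_two`; in particular `m ≤ 2`,
`Sheshadri2026_polarCount_le_of_m_le_two`), or `2m < N` (degenerate duals,
`Sheshadri2026_polarCount_le_of_two_mul_lt`). The complementary range — forms of degree `≥ 3`
with `m ≥ 3`, `4 ≤ N ≤ 2m` — is the intersection-theoretic content of the cited claim and is not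
formalised. [folklore] -/
theorem Sheshadri2026_polarCount_le_of_small_cases {σ : Type} [Fintype σ] [DecidableEq σ]
    (hσ : 3 ≤ Fintype.card σ) (f : MvPolynomial σ ℂ) (d m : ℕ)
    (hcase : Fintype.card σ = 3 ∨ f.totalDegree ≤ 2 ∨ m ≤ 2 ∨ 2 * m < Fintype.card σ)
    (hf : f.IsHomogeneous d) (hm : HasDetRepr f m) :
    ∃ Φ : MvPolynomial (Fin 3 × σ) ℂ, Φ ≠ 0 ∧ ∀ u : Fin 3 × σ → ℂ, eval u Φ ≠ 0 →
      (polarSet f (fun i => u (0, i)) (fun i => u (1, i)) (fun i => u (2, i))).ncard ≤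
        conormalBezout m (Fintype.card σ) := by
  rcases hcase with h3 | hdeg | h2 | hlt
  · exact Sheshadri2026_polarCount_le_of_card_eq_three h3 f d m hf hm
  · exact Sheshadri2026_polarCount_le_of_totalDegree_le_two hσ f d m hdeg hf hm
  · exact Sheshadri2026_polarCount_le_of_m_le_two hσ f d m h2 hf hm
  · exact Sheshadri2026_polarCount_le_of_two_mul_lt f m hlt hm

end Literature.Computability.AlgebraicComplexity
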